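import Literature.Computation.Certificates.ConicCertificateLayout
import Literature.Computation.Certificates.SemidefiniteRigorousBoundsNegSplit
import Mathlib.Analysis.Matrix.Spectrum

/-!
# Kernel-replayable layout of `certsdp-conic/1` WITH negative-part splits (`psd[k].neg_split`) and of
# `certsdp-problem/1` WITH a-priori operator bounds (`psd_blocks[k].lambda_max_bound`)

Topic `Literature/Computation/Certificates`; sibling of `ConicCertificateLayout.lean` (layout of
`certsdp-problem/1` + the lower kind `certsdp-conic/1`, soundness `ConicLayout.LowerCert.sound` =
corollary of `JanssonChaykinKeil.lmiForm_bound`) and of `SemidefiniteRigorousBoundsNegSplit.lean` (the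
bound formula with a negative-part split, `JanssonChaykinKeil.lmiForm_bound_negSplit`).  Nothing of either
file is restated or modified.  Added here (exact rational data, `Bool` check, soundness as a COROLLARY):
* `ProblemOp` = `Problem` + the OPTIONAL per-block member `lambda_max_bound` (an exact rational `x̄_k` the
  CLIENT vouches for: `x̄_k · 1 − M_k(y) ⪰ 0` for every feasible `y` of the program AS STATED; problem data
  under `problem_sha256` exactly like `trace_bound`); real semantics `ProblemOp.OpBounds`;
* `NegSplit` = the member `psd[k].neg_split = {W_rows (n_k × l_k integers), K}`, `W_k = W_rows/2^K`, with
  its exact Gram matrix `(W_rows W_rowsᵀ)/4^K` and Frobenius mass `‖W_rows‖_F²/4^K = tr(W_kᵀ W_k)`;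
* `LowerCertNS` = a lower certificate whose block `k` carries the UNCHANGED PSD witness of `P_k`
  (`BlockWitness`, check K-3 applied to `P_k` — N-5) and an optional split; the MULTIPLIER in every pairing
  is `Z_k := P_k − W_k W_kᵀ` (N-3), the bound formula gains `Σ_k x̄_k · ‖W_rows,k‖_F²/4^{K_k}` (N-4), a
  split block must declare `lambda_max_bound` (N-2) and have `l_k ≥ 1` (N-1); `check : Bool` = K-2, K-4,
  K-3, K-5, N-1/N-2 and `claimed ≤ β − ℓ₁ − Σ_k |min(0,d_k)| τ_k − Σ_k x̄_k ‖W_rows,k‖_F²/4^{K_k}`, written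
  as `checkWith … C.Zm` so that a replay can decide it in two stages (form the `Z_k`, then the pairings);
* `LowerCertNS.sound`: `check = true ⇒ claimed ≤ c·y + c₀` for every feasible `y` at which the declared
  trace bounds AND operator bounds hold; `sound'` (no trace bounds needed when every floor `d_k ≥ 0` — the
  Gram/Cholesky producer path), `le_csInf`, `le_csInf'`.  PROOF: `lmiForm_bound_negSplit` with
  `Z_k + W_k W_kᵀ = P_k ⪰ d_k · 1` from `BlockWitness.posSemidef_sub_dfloor`; a block WITHOUT a declared
  operator bound is fed the free bound `tr M_k(y) · 1 − M_k(y) ⪰ 0`, where its split is absent.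

Sources: certnum `sdp/FORMAT-conic1-negsplit-DRAFT.md` v0.6 §2–§4 and `READER-SPEC-v0` §3.1b (N-1…N-5)
for the certificate form; [JanssonChaykinKeil2008] Lemma 3.1 / Thm 3.2 with [Jansson2007] Lemma 4.1 /
Thm 4.1 (a) (p. 8), Cor. 6.1 (a) (p. 13) for the mathematics; [BurerMonteiro2003, §1 (2)] (Gram blocks),
[Rump1999VerifiedLargeSystems, §4] (residual floors).  NOT modelled (deliberately): the top-level
`requires: ["neg_split"]` member (N-0: it makes a reader WITHOUT the feature refuse the document — lineage,
not soundness), literal/size caps (L-4), report keys, the pinning of the producer's stated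
`claimed.neg_split_penalty` (the kernel RE-DERIVES the bound).  No named facts, no instances, no `sorry`.
-/

namespace Literature.Computation.Certificates

open Matrix Finset
open scoped BigOperators

namespace ConicLayout

variable {V E I K : Type*} [Fintype V] [DecidableEq V] [Fintype E] [Fintype I] [Fintype K]
variable {σ : K → Type*} [∀ k, Fintype (σ k)] [∀ k, DecidableEq (σ k)]
variable {π : K → Type*} [∀ k, Fintype (π k)]
variable {ω : K → Type*} [∀ k, Fintype (ω k)]

/-! ### §1 `certsdp-problem/1` with a-priori operator bounds -/

/-- `certsdp-problem/1` with the optional per-block member `psd_blocks[k].lambda_max_bound`: an exact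
rational `x̄_k` (`none` = absent) with `x̄_k · 1 − M_k(y) ⪰ 0` for every feasible `y` of the program as
stated — the a-priori upper bound `x̄` on the primal object of [cite: JanssonChaykinKeil2008, Thm 3.2
(a-priori bound x̄)] in OPERATOR form, [cite: Jansson2007, Cor 6.1 (a) (p0013), hypothesis
`λ_max(X) ≤ x̄`]; all other members are those of `Problem`. -/
structure ProblemOp (V E I K : Type*) (σ : K → Type*) extends Problem V E I K σ where
  /-- optional a-priori operator bounds `λ_max(M_k(y)) ≤ x̄_k` (`lambda_max_bound`) -/
  lamMax : K → Option ℚ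

namespace ProblemOp

/-- The declared OPERATOR BOUNDS hold at `y`: `x̄_k · 1 − M_k(y) ⪰ 0` wherever `lambda_max_bound` is
present — client-vouched side information, uniform over the feasible set of the program as stated.
[cite: Jansson2007, Cor 6.1 (a) (p0013), hypothesis `λ_max(X) ≤ x̄`] -/
def OpBounds (P : ProblemOp V E I K σ) (y : V → ℝ) : Prop :=
  ∀ k, ∀ q ∈ P.lamMax k,
    ((q : ℝ) • (1 : Matrix (σ k) (σ k) ℝ) - P.toProblem.block k y).PosSemidef

end ProblemOp

/-! ### §2 The split member `psd[k].neg_split` -/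

/-- The member `psd[k].neg_split = {"W_rows": n_k × l_k integers, "K": K}`: the subtracted factor
`W_k = W_rows / 2^K` of the negative-part split `Z_k = P_k − W_k W_kᵀ` — the certificate form of the
negative part `D⁻` of a dual multiplier in [cite: Jansson2007, Lemma 4.1 and Thm 4.1 (a) (p0008);
certificate (factor) form]. -/
structure NegSplit (m l : Type*) where
  /-- the split's own exponent `K` -/
  expo : ℕ
  /-- the integer factor `W_rows` (`n_k × l_k`) -/
  W : Matrix m l ℤ

namespace NegSplit

variable {m l : Type*} [Fintype l]

/-- The exact Gram matrix of the split, `W_k W_kᵀ = (W_rows W_rowsᵀ)/4^K`. [folklore] -/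
def gram (s : NegSplit m l) : Matrix m m ℚ :=
  fun a b => (∑ j, (s.W a j : ℚ) * s.W b j) / 4 ^ s.expo

/-- The exact Frobenius mass `‖W_rows‖_F²/4^K = tr(W_kᵀ W_k)` — the per-unit-`x̄_k` penalty of the split
(N-4). [folklore] -/
def frob [Fintype m] (s : NegSplit m l) : ℚ :=
  (∑ a, ∑ j, (s.W a j : ℚ) * s.W a j) / 4 ^ s.expo

/-- The real factor `W_k = 2^{-K} · W_rows`. [folklore] -/
noncomputable def real (s : NegSplit m l) : Matrix m l ℝ :=
  ((2 : ℝ) ^ s.expo)⁻¹ • s.W.map (Int.cast : ℤ → ℝ)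

omit [Fintype l] in
/-- `4^K = 2^K · 2^K` over `ℝ` (plumbing). [folklore] -/
private theorem four_pow_eq (K' : ℕ) : (4 : ℝ) ^ K' = (2 : ℝ) ^ K' * (2 : ℝ) ^ K' := by
  rw [← mul_pow]; norm_num

/-- The exact Gram matrix is `W_k W_kᵀ` over `ℝ` (plumbing). [folklore] -/
private theorem gram_map_eq (s : NegSplit m l) : s.gram.map (Rat.cast : ℚ → ℝ) = s.real * s.realᵀ := by
  ext a b
  simp only [gram, real, Matrix.map_apply, Matrix.mul_apply, Matrix.smul_apply,
    Matrix.transpose_apply, smul_eq_mul, Rat.cast_div, Rat.cast_sum, Rat.cast_mul, Rat.cast_intCast,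
    Rat.cast_pow, Rat.cast_ofNat]
  simp_rw [mul_mul_mul_comm ((2 : ℝ) ^ s.expo)⁻¹ _ ((2 : ℝ) ^ s.expo)⁻¹ _]
  rw [← Finset.mul_sum, four_pow_eq, div_eq_inv_mul, mul_inv]

/-- The exact Frobenius mass is `tr(W_kᵀ W_k)` over `ℝ` (plumbing). [folklore] -/
private theorem frob_eq [Fintype m] (s : NegSplit m l) : (s.frob : ℝ) = trace (s.realᵀ * s.real) := by
  simp only [frob, real, Matrix.trace, Matrix.diag, Matrix.mul_apply, Matrix.transpose_apply,
    Matrix.smul_apply, Matrix.map_apply, smul_eq_mul, Rat.cast_div, Rat.cast_sum, Rat.cast_mul,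
    Rat.cast_intCast, Rat.cast_pow, Rat.cast_ofNat]
  rw [Finset.sum_comm]
  simp_rw [mul_mul_mul_comm ((2 : ℝ) ^ s.expo)⁻¹ _ ((2 : ℝ) ^ s.expo)⁻¹ _]
  rw [four_pow_eq, div_eq_inv_mul, mul_inv, Finset.mul_sum]
  exact Finset.sum_congr rfl fun j _ => by rw [Finset.mul_sum]

end NegSplit

/-- The exact Gram matrix of an optional split (`0` when the member is absent). [folklore] -/
def splitGram {m l : Type*} [Fintype l] : Option (NegSplit m l) → Matrix m m ℚ
  | none => 0
  | some s => s.gram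

/-- The exact Frobenius mass of an optional split (`0` when absent). [folklore] -/
def splitFrob {m l : Type*} [Fintype m] [Fintype l] : Option (NegSplit m l) → ℚ
  | none => 0
  | some s => s.frob

/-- The real factor of an optional split (`0` when absent). [folklore] -/
noncomputable def splitReal {m l : Type*} [Fintype l] : Option (NegSplit m l) → Matrix m l ℝ
  | none => 0
  | some s => s.real

omit [Fintype V] [DecidableEq V] [Fintype E] [Fintype I] [Fintype K] in
/-- `splitGram = W Wᵀ` over `ℝ` for the optional split. [folklore] -/
private theorem splitGram_map_eq {m l : Type*} [Fintype l] (o : Option (NegSplit m l)) :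
    (splitGram o).map (Rat.cast : ℚ → ℝ) = splitReal o * (splitReal o)ᵀ := by
  cases o with
  | none => ext a b; simp [splitGram, splitReal]
  | some s => exact s.gram_map_eq

omit [Fintype V] [DecidableEq V] [Fintype E] [Fintype I] [Fintype K] in
/-- `splitFrob = tr(Wᵀ W)` over `ℝ` for the optional split. [folklore] -/
private theorem splitFrob_eq {m l : Type*} [Fintype m] [Fintype l] (o : Option (NegSplit m l)) :
    (splitFrob o : ℝ) = trace ((splitReal o)ᵀ * splitReal o) := by
  cases o with
  | none => simp [splitFrob, splitReal]
  | some s => exact s.frob_eq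

/-! ### §3 `certsdp-conic/1` with splits: the rigorous LOWER bound -/

/-- A lower certificate of kind `certsdp-conic/1` whose blocks may carry `neg_split`: multipliers `λ`
(free), `κ`, per block the PSD witness of `P_k` (Gram or dyadic-eig, as without splits) and an optional
split `W_k`, and `claimed.lower_bound`; the block multiplier is `Z_k = P_k − W_k W_kᵀ` — the data of the
rigorous lower bound of [cite: JanssonChaykinKeil2008, Thm 3.2 (inequality-form corollary)] with the
negative-part penalty of [cite: Jansson2007, Thm 4.1 (a) (p0008) and Cor 6.1 (a) (p0013); certificate
(split) form]. -/
structure LowerCertNS (V E I K : Type*) (σ π ω : K → Type*) where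
  /-- equality multipliers `λ_e` (free sign) -/
  lam : E → ℚ
  /-- inequality multipliers `κ_i` (must be `≥ 0`) -/
  kap : I → ℚ
  /-- the PSD witnesses of the certified parts `P_k`, block by block -/
  wit : ∀ k, BlockWitness (σ k) (π k)
  /-- the optional splits `psd[k].neg_split` -/
  split : ∀ k, Option (NegSplit (σ k) (ω k))
  /-- `claimed.lower_bound` -/
  lowerBound : ℚ

namespace LowerCertNS

/-- The block MULTIPLIER `Z_k = P_k − W_k W_kᵀ` (exact; `= P_k` without a split) — N-3. [folklore] -/
def Zm (C : LowerCertNS V E I K σ π ω) (k : K) : Matrix (σ k) (σ k) ℚ :=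
  (C.wit k).Z - splitGram (C.split k)

/-- The exact residual `r_v = c_v − Σ_e λ_e row_e[v] + Σ_i κ_i row_i[v] − Σ_k ⟨Z_k, F_{k,v}⟩` for GIVEN
block multipliers `Z_k` (K-1 / N-3; the reader forms the `Z_k` once, exactly, and then the pairings —
two-stage evaluation). [folklore] -/
def residualWith (P : ProblemOp V E I K σ) (C : LowerCertNS V E I K σ π ω)
    (Zs : ∀ k, Matrix (σ k) (σ k) ℚ) (v : V) : ℚ :=
  P.c v - ∑ e, C.lam e * P.rowE e v + ∑ i, C.kap i * P.rowI i v - ∑ k, pairing (Zs k) (P.F k v)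

/-- The exact residual with the certificate's split multipliers `Z_k = P_k − W_k W_kᵀ`. [folklore] -/
def residual (P : ProblemOp V E I K σ) (C : LowerCertNS V E I K σ π ω) (v : V) : ℚ :=
  residualWith P C C.Zm v

/-- `β = c₀ + r_u + Σ_e λ_e rhs_e − Σ_i κ_i upper_i − Σ_k ⟨Z_k, Cb_k⟩` for given block multipliers
(`claimed.beta`). [folklore] -/
def betaWith (P : ProblemOp V E I K σ) (C : LowerCertNS V E I K σ π ω)
    (Zs : ∀ k, Matrix (σ k) (σ k) ℚ) : ℚ :=
  P.c0 + residualWith P C Zs P.unit + ∑ e, C.lam e * P.rhs e - ∑ i, C.kap i * P.upper i -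
    ∑ k, pairing (Zs k) (P.Cb k)

/-- `β` with the certificate's split multipliers. [folklore] -/
def beta (P : ProblemOp V E I K σ) (C : LowerCertNS V E I K σ π ω) : ℚ :=
  betaWith P C C.Zm

/-- The `ℓ₁` charge `Σ_{v ≠ u} |r_v| ρ_v` for given block multipliers (`claimed.l1_term`; unbounded
variables are charged `0` and must carry `r_v = 0`, K-4). [folklore] -/
def l1With (P : ProblemOp V E I K σ) (C : LowerCertNS V E I K σ π ω)
    (Zs : ∀ k, Matrix (σ k) (σ k) ℚ) : ℚ :=
  ∑ v ∈ univ.erase P.unit, |residualWith P C Zs v| * (P.rho v).getD 0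

/-- The `ℓ₁` charge with the certificate's split multipliers. [folklore] -/
def l1 (P : ProblemOp V E I K σ) (C : LowerCertNS V E I K σ π ω) : ℚ :=
  l1With P C C.Zm

/-- The trace penalty `Σ_k |min(0, d_k)| τ_k` of the certified parts (`claimed.trace_penalty`, K-5).
[folklore] -/
def penalty (P : ProblemOp V E I K σ) (C : LowerCertNS V E I K σ π ω) : ℚ :=
  ∑ k, |min 0 (C.wit k).dfloor| * (P.tau k).getD 0

/-- The split penalty `Σ_k x̄_k · ‖W_rows,k‖_F²/4^{K_k}` (`claimed.neg_split_penalty` summed over the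
split blocks; `0` for a block without a split), N-4. [folklore] -/
def nsPenalty (P : ProblemOp V E I K σ) (C : LowerCertNS V E I K σ π ω) : ℚ :=
  ∑ k, (P.lamMax k).getD 0 * splitFrob (C.split k)

/-- **Acceptance of a lower certificate with splits, for given block multipliers** `Z_k` (the reader's
decision on the exact data, second stage): `κ ≥ 0` (K-2); zero residual on unbounded variables (K-4); the
eigen row checks of the certified parts `P_k` (K-3, unchanged — N-5); a trace bound wherever `d_k < 0`
(K-5); every split has `l_k ≥ 1` columns (N-1) and sits on a block with a declared `lambda_max_bound`
(N-2); and `claimed ≤ β − ℓ₁ − penalty − nsPenalty` (the bound formula, N-3/N-4).  A `Bool` of the exact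
data (kernel-evaluable by `decide`). [folklore] -/
def checkWith (P : ProblemOp V E I K σ) (C : LowerCertNS V E I K σ π ω)
    (Zs : ∀ k, Matrix (σ k) (σ k) ℚ) : Bool :=
  decide (∀ i, 0 ≤ C.kap i) &&
    decide (∀ v, v ≠ P.unit → P.rho v = none → residualWith P C Zs v = 0) &&
    decide (∀ k, (C.wit k).rowsOk = true) &&
    decide (∀ k, (C.wit k).dfloor < 0 → (P.tau k).isSome = true) &&
    decide (∀ k, (C.split k).isSome = true → 0 < Fintype.card (ω k) ∧ (P.lamMax k).isSome = true) &&
    decide (C.lowerBound ≤ betaWith P C Zs - l1With P C Zs - penalty P C - nsPenalty P C)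

/-- **Acceptance of a lower certificate with splits** = `checkWith` at the certificate's own multipliers
`Z_k = P_k − W_k W_kᵀ` (so `check P C = checkWith P C C.Zm` by `rfl`: a replay may first establish
`C.Zm = Z` for literal matrices `Z` by one kernel evaluation, `unfold check`, rewrite, and then decide
`checkWith P C Z` — the pairings then read the entries of `Z` instead of re-forming them). [folklore] -/
def check (P : ProblemOp V E I K σ) (C : LowerCertNS V E I K σ π ω) : Bool :=
  checkWith P C C.Zm

omit [Fintype V] [DecidableEq V] [Fintype E] [Fintype I] [Fintype K] in
/-- `tr (Z F) = ⟨Z, F⟩` after casting to `ℝ` (plumbing). [folklore] -/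
private theorem trace_map_mul_map' {m : Type*} [Fintype m] (Z F : Matrix m m ℚ) :
    trace (Z.map (Rat.cast : ℚ → ℝ) * F.map (Rat.cast : ℚ → ℝ)) = (pairing Z F : ℝ) := by
  simp [Matrix.trace, Matrix.mul_apply, pairing, Rat.cast_sum, Rat.cast_mul]

omit [Fintype V] [DecidableEq V] [Fintype E] [Fintype I] [Fintype K] in
/-- `λ_max(A) ≤ tr A` for a real `A ⪰ 0`, in Loewner form `(tr A) · 1 − A ⪰ 0` — the operator bound
every PSD block obeys for free (spectral theorem: `tr A − λ_i = Σ_{j ≠ i} λ_j ≥ 0`); used only to feed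
`lmiForm_bound_negSplit` on blocks without a declared operator bound (plumbing). [folklore] -/
private theorem posSemidef_trace_smul_one_sub_real {m : Type*} [Fintype m] [DecidableEq m]
    {A : Matrix m m ℝ} (hA : A.PosSemidef) : (A.trace • (1 : Matrix m m ℝ) - A).PosSemidef := by
  have hH : A.IsHermitian := hA.1
  set U : Matrix m m ℝ := (hH.eigenvectorUnitary : Matrix m m ℝ) with hU
  have h1 : U * star U = 1 := Matrix.mem_unitaryGroup_iff.1 hH.eigenvectorUnitary.2
  have hspec : A = U * diagonal (RCLike.ofReal ∘ hH.eigenvalues) * star U := by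
    have hs := hH.spectral_theorem
    rw [Unitary.conjStarAlgAut_apply] at hs
    simpa [hU] using hs
  have hsum : A.trace = ∑ i, hH.eigenvalues i := by
    simpa using hH.trace_eq_sum_eigenvalues
  have hD : (diagonal fun i => A.trace - hH.eigenvalues i).PosSemidef := by
    rw [posSemidef_diagonal_iff]
    intro i
    rw [hsum]
    exact sub_nonneg.2 (Finset.single_le_sum (fun j _ => hA.eigenvalues_nonneg j) (Finset.mem_univ i))
  have hdiag : (diagonal fun i => A.trace - hH.eigenvalues i) =
      A.trace • (1 : Matrix m m ℝ) - diagonal (RCLike.ofReal ∘ hH.eigenvalues) := by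
    ext i j
    by_cases hij : i = j
    · subst hij; simp
    · simp [hij]
  have key : A.trace • (1 : Matrix m m ℝ) - A =
      U * (diagonal fun i => A.trace - hH.eigenvalues i) * Uᴴ := by
    rw [hdiag, Matrix.mul_sub, Matrix.sub_mul, Matrix.mul_smul, Matrix.mul_one, Matrix.smul_mul,
      ← star_eq_conjTranspose, h1, ← hspec]
  rw [key]
  exact hD.mul_mul_conjTranspose_same U

/-- The core estimate: an accepted split certificate bounds the objective at every feasible `y` at
which the declared operator bounds hold, given real trace majorants `τ_k ≥ tr M_k(y)` whose penalty
`Σ_k |min(0,d_k)| τ_k` is covered by the certificate's. [cite: JanssonChaykinKeil2008, Lemma 3.1 and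
Thm 3.2; Jansson2007, Lemma 4.1 and Thm 4.1 (a) (p0008), Cor 6.1 (a) (p0013) (inequality-form
corollary with certificate splits)] -/
private theorem bound_core {P : ProblemOp V E I K σ} {C : LowerCertNS V E I K σ π ω}
    (h : check P C = true) {y : V → ℝ} (hy : P.toProblem.Feasible y) (hop : P.OpBounds y)
    (τ : K → ℝ) (hτ : ∀ k, (P.toProblem.block k y).trace ≤ τ k)
    (hpen : ∑ k, |min 0 ((C.wit k).dfloor : ℝ)| * τ k ≤ (penalty P C : ℝ)) :
    (C.lowerBound : ℝ) ≤ P.toProblem.obj y := by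
  simp only [check, checkWith, Bool.and_eq_true, decide_eq_true_eq] at h
  obtain ⟨⟨⟨⟨⟨hκ, hnone⟩, hrows⟩, _⟩, hsplit⟩, hlb⟩ := h
  -- the box actually used: `ρ_v`, or `|y_v|` itself for an unbounded variable (its residual is `0`)
  let ρ : V → ℝ := fun v => (P.rho v).elim |y v| fun q => (q : ℝ)
  have hρ : ∀ v, v ≠ P.unit → |y v| ≤ ρ v := by
    intro v _
    cases hq : P.rho v with
    | none => simp [ρ, hq]
    | some q => simpa [ρ, hq] using hy.box v q (by simp [hq])
  -- the operator bound actually used: `x̄_k`, or `tr M_k(y)` for a block without a declared bound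
  let xb : K → ℝ := fun k => (P.lamMax k).elim (P.toProblem.block k y).trace fun q => (q : ℝ)
  have hxb : ∀ k, (xb k • (1 : Matrix (σ k) (σ k) ℝ) - P.toProblem.block k y).PosSemidef := by
    intro k
    cases hq : P.lamMax k with
    | none => simpa [xb, hq] using posSemidef_trace_smul_one_sub_real (hy.psd k)
    | some q => simpa [xb, hq] using hop k q (by simp [hq])
  have hblock : ∀ k, P.toProblem.block k y =
      (P.Cb k).map (Rat.cast : ℚ → ℝ) + ∑ v, y v • (P.F k v).map (Rat.cast : ℚ → ℝ) := fun k => rfl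
  -- the certified parts dominate their floors: `Z_k + W_k W_kᵀ = P_k ⪰ d_k · 1`
  have hZ : ∀ k, ((C.Zm k).map (Rat.cast : ℚ → ℝ) + splitReal (C.split k) * (splitReal (C.split k))ᵀ -
      ((C.wit k).dfloor : ℝ) • (1 : Matrix (σ k) (σ k) ℝ)).PosSemidef := by
    intro k
    have e : (C.Zm k).map (Rat.cast : ℚ → ℝ) + splitReal (C.split k) * (splitReal (C.split k))ᵀ =
        (C.wit k).Z.map (Rat.cast : ℚ → ℝ) := by
      rw [← splitGram_map_eq]
      ext a b
      simp [Zm]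
    rw [e]
    exact (C.wit k).posSemidef_sub_dfloor (hrows k)
  have hmain := JanssonChaykinKeil.lmiForm_bound_negSplit (fun v => (P.c v : ℝ)) (P.c0 : ℝ) P.unit
    (fun e v => (P.rowE e v : ℝ)) (fun e => (P.rhs e : ℝ)) (fun i v => (P.rowI i v : ℝ))
    (fun i => (P.upper i : ℝ)) (fun k => (P.Cb k).map (Rat.cast : ℚ → ℝ))
    (fun k v => (P.F k v).map (Rat.cast : ℚ → ℝ)) ρ τ xb hy.unit hρ hy.eq hy.le hy.psd hτ
    (fun k => by rw [← hblock]; exact hxb k)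
    (fun e => (C.lam e : ℝ)) (fun i => (C.kap i : ℝ)) (fun i => by exact_mod_cast hκ i)
    (fun k => (C.Zm k).map (Rat.cast : ℚ → ℝ)) (fun k => splitReal (C.split k))
    (fun k => ((C.wit k).dfloor : ℝ)) hZ (fun v => (residual P C v : ℝ))
    (fun v => by
      simp only [residual, residualWith, Rat.cast_sub, Rat.cast_add, Rat.cast_sum, Rat.cast_mul,
        trace_map_mul_map'])
    (beta P C : ℝ)
    (by simp only [beta, betaWith, residual, residualWith, Rat.cast_sub, Rat.cast_add, Rat.cast_sum,
      Rat.cast_mul, trace_map_mul_map'])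
  have hl1 : (l1 P C : ℝ) = ∑ v ∈ univ.erase P.unit, |(residual P C v : ℝ)| * ρ v := by
    rw [l1, l1With, Rat.cast_sum]
    refine Finset.sum_congr rfl fun v hv => ?_
    have hvu : v ≠ P.unit := Finset.ne_of_mem_erase hv
    cases hq : P.rho v with
    | none => simp [residual, hnone v hvu hq]
    | some q => simp [residual, ρ, hq, Rat.cast_mul, Rat.cast_abs]
  -- the split penalty of the certificate IS `Σ_k x̄_k tr(W_kᵀ W_k)` (a split block carries `x̄_k`, N-2)
  have hns : (nsPenalty P C : ℝ) = ∑ k, xb k * trace ((splitReal (C.split k))ᵀ * splitReal (C.split k)) := by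
    rw [nsPenalty, Rat.cast_sum]
    refine Finset.sum_congr rfl fun k _ => ?_
    rw [Rat.cast_mul, splitFrob_eq]
    cases hs : C.split k with
    | none => simp [splitReal]
    | some s =>
        obtain ⟨_, hsome⟩ := hsplit k (by simp [hs])
        obtain ⟨q, hq⟩ := Option.isSome_iff_exists.1 hsome
        simp [xb, hq]
  have hlb' : (C.lowerBound : ℝ) ≤
      (beta P C : ℝ) - (l1 P C : ℝ) - (penalty P C : ℝ) - (nsPenalty P C : ℝ) := by
    simp only [beta, l1]
    exact_mod_cast hlb
  rw [hl1, hns] at hlb'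
  have hobj : P.toProblem.obj y = ∑ v, (P.c v : ℝ) * y v + P.c0 := rfl
  linarith

/-- **Soundness of the lower certificate with splits** (`certsdp-conic/1` + `neg_split`): if the
certificate is accepted then `claimed.lower_bound ≤ c·y + c₀` for every feasible `y` at which the
declared a-priori trace bounds AND operator bounds hold — `JanssonChaykinKeil.lmiForm_bound_negSplit`
with `Z_k + W_k W_kᵀ = P_k ⪰ d_k · 1` supplied by the block witnesses.
[cite: JanssonChaykinKeil2008, Lemma 3.1 and Thm 3.2; Jansson2007, Lemma 4.1 and Thm 4.1 (a) (p0008),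
Cor 6.1 (a) (p0013) (inequality-form corollary with certificate splits)]
[cite: Rump1999VerifiedLargeSystems, §4, Algorithm 4.1 step 7] -/
theorem sound {P : ProblemOp V E I K σ} {C : LowerCertNS V E I K σ π ω} (h : check P C = true)
    {y : V → ℝ} (hy : P.toProblem.Feasible y) (htr : P.toProblem.TraceBounds y) (hop : P.OpBounds y) :
    (C.lowerBound : ℝ) ≤ P.toProblem.obj y := by
  have hsome : ∀ k, (C.wit k).dfloor < 0 → (P.tau k).isSome = true := by
    have h' := h
    simp only [check, checkWith, Bool.and_eq_true, decide_eq_true_eq] at h'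
    exact h'.1.1.2
  -- trace majorants: the declared bound where present, the trace itself otherwise
  let τ : K → ℝ := fun k => (P.tau k).elim (P.toProblem.block k y).trace fun q => (q : ℝ)
  refine bound_core h hy hop τ (fun k => ?_) (le_of_eq ?_)
  · cases hq : P.tau k with
    | none => simp [τ, hq]
    | some q => simpa [τ, hq] using htr k q (by simp [hq])
  · rw [penalty, Rat.cast_sum]
    refine Finset.sum_congr rfl fun k _ => ?_
    cases hq : P.tau k with
    | none =>
        have h0 : 0 ≤ (C.wit k).dfloor := by
          by_contra hlt
          have := hsome k (lt_of_not_ge hlt)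
          simp [hq] at this
        have h0' : (0 : ℝ) ≤ ((C.wit k).dfloor : ℝ) := by exact_mod_cast h0
        simp [min_eq_left h0', min_eq_left h0]
    | some q => simp [τ, hq, Rat.cast_mul, Rat.cast_abs, Rat.cast_min]

/-- **Soundness without trace bounds**: if moreover every eigenvalue floor of the certified parts is
`≥ 0` (in particular when every `P_k` is a Gram witness — the producer's Cholesky path), the bound holds
at EVERY feasible `y` satisfying the declared operator bounds. [cite: JanssonChaykinKeil2008, Thm 3.2
(inequality-form corollary, case without penalised blocks); Jansson2007, Thm 4.1 (a) (p0008), Cor 6.1 (a)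
(p0013)] [cite: BurerMonteiro2003, §1 eq. (2)] -/
theorem sound' {P : ProblemOp V E I K σ} {C : LowerCertNS V E I K σ π ω} (h : check P C = true)
    (h0 : ∀ k, 0 ≤ (C.wit k).dfloor) {y : V → ℝ} (hy : P.toProblem.Feasible y) (hop : P.OpBounds y) :
    (C.lowerBound : ℝ) ≤ P.toProblem.obj y := by
  refine bound_core h hy hop (fun k => (P.toProblem.block k y).trace) (fun k => le_rfl) ?_
  have hl : ∑ k, |min 0 ((C.wit k).dfloor : ℝ)| * (P.toProblem.block k y).trace = 0 :=
    Finset.sum_eq_zero fun k _ => by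
      rw [min_eq_left (show (0 : ℝ) ≤ ((C.wit k).dfloor : ℝ) by exact_mod_cast h0 k), abs_zero,
        zero_mul]
  have hr : penalty P C = 0 :=
    Finset.sum_eq_zero fun k _ => by rw [min_eq_left (h0 k), abs_zero, zero_mul]
  rw [hl, hr, Rat.cast_zero]

/-- The accepted bound is below the INFIMUM of the objective over the feasible points satisfying the
declared trace and operator bounds (nonempty such set). [cite: JanssonChaykinKeil2008, Thm 3.2
(inequality-form corollary); Jansson2007, Thm 4.1 (a) (p0008), Cor 6.1 (a) (p0013)] -/
theorem le_csInf {P : ProblemOp V E I K σ} {C : LowerCertNS V E I K σ π ω} (h : check P C = true)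
    (hne : (P.toProblem.obj ''
      {y | P.toProblem.Feasible y ∧ P.toProblem.TraceBounds y ∧ P.OpBounds y}).Nonempty) :
    (C.lowerBound : ℝ) ≤
      sInf (P.toProblem.obj '' {y | P.toProblem.Feasible y ∧ P.toProblem.TraceBounds y ∧ P.OpBounds y}) :=
  _root_.le_csInf hne (by rintro _ ⟨y, ⟨hy, htr, hop⟩, rfl⟩; exact sound h hy htr hop)

/-- Without penalised blocks: the accepted bound is below the infimum over all feasible points
satisfying the declared operator bounds. [cite: JanssonChaykinKeil2008, Thm 3.2 (inequality-form
corollary); Jansson2007, Thm 4.1 (a) (p0008), Cor 6.1 (a) (p0013)] -/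
theorem le_csInf' {P : ProblemOp V E I K σ} {C : LowerCertNS V E I K σ π ω} (h : check P C = true)
    (h0 : ∀ k, 0 ≤ (C.wit k).dfloor)
    (hne : (P.toProblem.obj '' {y | P.toProblem.Feasible y ∧ P.OpBounds y}).Nonempty) :
    (C.lowerBound : ℝ) ≤ sInf (P.toProblem.obj '' {y | P.toProblem.Feasible y ∧ P.OpBounds y}) :=
  _root_.le_csInf hne (by rintro _ ⟨y, ⟨hy, hop⟩, rfl⟩; exact sound' h h0 hy hop)

end LowerCertNS

end ConicLayout

end Literature.Computation.Certificates
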